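import Mathlib

/-!
# E-an-139a `AffineRecurrenceRigidity` — rigidity of a periodic order-two affine recurrence (the algebraic core of THEOREM Z,
# MEMO-an §72.2 step (4); an g30, HOME/an/g30/Sketch-an-g30.lean §2, ask T-an-34 / «p2: L1»)

Summit `BirchSwinnertonDyer`, route `ManinLocalTwoThree` (cell bsd-f2-manin, analytic lens), cruxes C3 `ManinPrimeToThreeAtNine`
(stmt-BirchSwinnertonDyer-22968) / C2 `ManinOddAtFour` (stmt-…-22967): rung L1 of the formalisation ladder MEMO-an §72.7 for the EXTENSION
step of the q-tower law.  STATEMENT (= `BsdF2ManinAnG30.AffineRecurrenceRigidity`, VERBATIM, proved BY VALUE since the g30 `def` is not yet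
in the tree): over a field `K` with `q ≠ 0`, if `q·x(m+2) = a·x(m+1) − x(m) + κ` and `x(m + w) = x(m)` for all `m ≥ s` (`w ≥ 1`), and
`X² − aX + q` is coprime to `X^w − 1` in `K[X]`, then `x` is constant from `s` on and `(q + 1 − a)·x(s) = κ`.

PROOF.  The differences `z(m) = x(s+m+1) − x(s+m)` satisfy the homogeneous recurrence and are `w`-periodic for ALL `m`.  On `w`-periodic
sequences the BACKWARD shift `(Bz)(m) = z(m + w − 1)` is a `K`-linear operator with `B^w z = z` and — by the recurrence read backwards —
`(B² − aB + q) z = 0`; a Bezout relation `u·(X² − aX + q) + v·(X^w − 1) = 1` evaluated at `B` gives `z = 0`.  (The roots of `X² − aX + q`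
are the Frobenius eigenvalues `λ`, those of `B` on periodic sequences are `w`-th roots of unity — hypothesis (EV) of THEOREM Z.)

HONEST FRAMING: pure linear algebra (support item E-an-139a); nothing about modular symbols, Manin's conjecture or BSD is asserted.
-/

set_option linter.dupNamespace false
set_option autoImplicit false

namespace Summit.BirchSwinnertonDyer.BirchSwinnertonDyer.Theorems.ManinLocalTwoThree

open Polynomial

/-- Powers of the shift `(Bv)(m) = v(m + d)`: `(B^k v)(m) = v(m + k·d)`. -/
theorem funLeft_add_pow_apply (K : Type) [Field K] (d k : ℕ) (v : ℕ → K) (m : ℕ) :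
    ((LinearMap.funLeft K K (fun m : ℕ ↦ m + d)) ^ k) v m = v (m + k * d) := by
  induction k generalizing m with
  | zero => simp
  | succ k ih =>
    rw [pow_succ', Module.End.mul_apply, LinearMap.funLeft_apply, ih]
    congr 1
    ring

/-- A `w`-periodic sequence is invariant under shifts by multiples of `w`. -/
theorem periodic_add_mul {K : Type} {w : ℕ} {v : ℕ → K} (hv : ∀ m, v (m + w) = v m) (j m : ℕ) :
    v (m + j * w) = v m := by
  induction j with
  | zero => simp
  | succ j ih => rw [Nat.succ_mul, ← add_assoc, hv, ih]

/-- **E-an-139a `AffineRecurrenceRigidity` (an g30, Sketch-an-g30 §2 VERBATIM), PROVED.**  A `w`-periodic solution of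
`q·x(m+2) = a·x(m+1) − x(m) + κ` (`m ≥ s`, `q ≠ 0`) is constant from `s` on, with `(q + 1 − a)·x(s) = κ`, provided `X² − aX + q` and
`X^w − 1` are coprime. -/
theorem affineRecurrenceRigidity :
    ∀ (K : Type) [Field K] (a q κ : K) (w s : ℕ) (x : ℕ → K),
      q ≠ 0 → 0 < w →
      (∀ m : ℕ, s ≤ m → q * x (m + 2) = a * x (m + 1) - x m + κ) →
      (∀ m : ℕ, s ≤ m → x (m + w) = x m) →
      IsCoprime (Polynomial.X ^ 2 - Polynomial.C a * Polynomial.X + Polynomial.C q : Polynomial K) (Polynomial.X ^ w - 1) →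
      (∀ m : ℕ, s ≤ m → x m = x s) ∧ (q + 1 - a) * x s = κ := by
  intro K _ a q κ w s x hq hw hrec hper hcop
  -- the differences `z(m) = x(s+m+1) − x(s+m)` (kept opaque)
  obtain ⟨z, hz⟩ : ∃ z : ℕ → K, ∀ m, z m = x (s + m + 1) - x (s + m) := ⟨_, fun _ ↦ rfl⟩
  have hzrec : ∀ m : ℕ, q * z (m + 2) = a * z (m + 1) - z m := by
    intro m
    have h1 := hrec (s + m + 1) (by omega)
    have h2 := hrec (s + m) (by omega)
    rw [hz, hz, hz]
    have e1 : s + (m + 2) + 1 = s + m + 1 + 2 := by ring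
    have e2 : s + (m + 2) = s + m + 2 := by ring
    have e3 : s + (m + 1) + 1 = s + m + 2 := by ring
    have e4 : s + (m + 1) = s + m + 1 := by ring
    have e5 : s + m + 1 + 1 = s + m + 2 := by ring
    rw [e1, e2, e3, e4]
    rw [e5] at h1
    linear_combination h1 - h2
  have hzper : ∀ m : ℕ, z (m + w) = z m := by
    intro m
    rw [hz, hz]
    have h1 := hper (s + m + 1) (by omega)
    have h2 := hper (s + m) (by omega)
    have e1 : s + (m + w) + 1 = s + m + 1 + w := by ring
    have e2 : s + (m + w) = s + m + w := by ring
    rw [e1, e2, h1, h2]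
  -- the backward shift `B` on sequences: `(Bv)(m) = v(m + (w-1))`
  set B : Module.End K (ℕ → K) := LinearMap.funLeft K K (fun m : ℕ ↦ m + (w - 1)) with hB
  have hBpow : ∀ (k : ℕ) (v : ℕ → K) (m : ℕ), (B ^ k) v m = v (m + k * (w - 1)) :=
    fun k v m ↦ funLeft_add_pow_apply K (w - 1) k v m
  have hB1 : ∀ (v : ℕ → K) (m : ℕ), B v m = v (m + (w - 1)) := fun v m ↦ rfl
  -- `(B² − aB + q) z = 0`
  have hQ : (Polynomial.aeval B (X ^ 2 - C a * X + C q : K[X])) z = 0 := by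
    funext m
    simp only [map_add, map_sub, map_mul, map_pow, Polynomial.aeval_X, Polynomial.aeval_C,
      LinearMap.add_apply, LinearMap.sub_apply, Module.End.mul_apply, Module.algebraMap_end_apply, Pi.add_apply,
      Pi.sub_apply, Pi.smul_apply, Pi.zero_apply, smul_eq_mul, hBpow, hB1]
    -- goal: z (m + 2*(w-1)) - a * z (m + (w-1)) + q * z m = 0
    have hrec' := hzrec (m + 2 * (w - 1))
    have hp1 : z (m + 2 * (w - 1) + 1) = z (m + (w - 1)) := by
      have := hzper (m + (w - 1))
      have e : m + (w - 1) + w = m + 2 * (w - 1) + 1 := by omega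
      rw [e] at this
      exact this
    have hp2 : z (m + 2 * (w - 1) + 2) = z m := by
      have := periodic_add_mul hzper 2 m
      have e : m + 2 * w = m + 2 * (w - 1) + 2 := by omega
      rw [e] at this
      exact this
    rw [hp1, hp2] at hrec'
    linear_combination hrec'
  -- `(B^w − 1) z = 0`
  have hW : (Polynomial.aeval B (X ^ w - 1 : K[X])) z = 0 := by
    funext m
    simp only [map_sub, map_pow, map_one, Polynomial.aeval_X, LinearMap.sub_apply, Module.End.one_apply, Pi.sub_apply,
      Pi.zero_apply, hBpow]
    rw [show m + w * (w - 1) = m + (w - 1) * w by ring, periodic_add_mul hzper (w - 1) m, sub_self]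
  -- Bezout: `z = (u·Q + v·(X^w − 1))(B) z = 0`
  have hz0 : z = 0 := by
    obtain ⟨u, v, huv⟩ := hcop
    have h := congrArg (fun P : K[X] ↦ (Polynomial.aeval B P) z) huv
    rw [map_add, map_mul, map_mul, map_one, LinearMap.add_apply, Module.End.mul_apply, Module.End.mul_apply, hQ, hW,
      map_zero, map_zero, add_zero, Module.End.one_apply] at h
    exact h.symm
  -- `x` is constant from `s` on
  have hconst : ∀ k : ℕ, x (s + k) = x s := by
    intro k
    induction k with
    | zero => simp
    | succ k ih =>
      have h := congrFun hz0 k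
      rw [Pi.zero_apply, hz, sub_eq_zero] at h
      rw [show s + (k + 1) = s + k + 1 by ring, h, ih]
  refine ⟨fun m hm ↦ ?_, ?_⟩
  · obtain ⟨k, rfl⟩ := Nat.exists_eq_add_of_le hm
    exact hconst k
  · have h := hrec s le_rfl
    rw [hconst 2, hconst 1] at h
    linear_combination h

end Summit.BirchSwinnertonDyer.BirchSwinnertonDyer.Theorems.ManinLocalTwoThree
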